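import Mathlib
import Summits.Ventures.PercRepro2.Defs
import Summits.Ventures.PercRepro2.Independence
import Summits.Ventures.PercRepro2.Graph
import Summits.Ventures.PercRepro2.Induced
import Summits.Ventures.PercRepro2.DisagreementSum
import Summits.Ventures.PercRepro2.DisagreementPinned
import Summits.Ventures.PercRepro2.HullDefs

/-!
# The switching map of (BASE) (blind cell PercRepro2, typer-1; mine-2 g8
`proofs/MINE2-SWITCHING.md` §0 and §3, lead g10 ask 2026-08-23T07:02:33Z "SwitchDefs")

On the minor with free edges `G` (pinned edges keep their value in both colours) the red graph of
a colouring `ζ` is `ζ` and the blue graph is `flipOn G ζ`. With the clusters `RL = C_R(l)`,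
`BL = C_B(l)`, `RH = C_R(h)`, `BH = C_B(h)`:

* `Qhat` = `{h ∉ RL} ∩ {h ∉ BL}`, `PlusSet` = `{Q̂, o ∈ RL ∖ BL, b ∈ RH ∖ BH}` (the `+1`
  configurations), `MinusSet` = `{Q̂, o ∈ RL ∖ BL, b ∈ BH ∖ RH}` (the `−1` configurations with the
  side of `o` unchanged) — (BASE) is `|PlusSet| ≤ |MinusSet|` fibre by fibre;
* `freeFlip S ζ` = recolour every FREE edge with an endpoint in `S` (`flip_S`);
* `kept = RL ∪ BH`, `Rplus` = the red clusters hanging off `BH` into `W = V ∖ kept`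
  (red paths from `BH` through edges touching `W`), `switchMap ζ = freeFlip Rplus ζ`;
* the three adjacency facts (F1)–(F3) of §3 and the first two claims of the THEOREM (total
  switching map): `RL ⊆ RL′` (`cluster_subset_switch`) and `BH ∪ R⁺ ⊆ BH′`
  (`cluster_blue_subset_switch`, `Rplus_subset_cluster_blue_switch`); the remaining claims
  (`BH′ ⊆ BH ∪ R⁺`, `RH′ ⊆ BH ∖ RL`, `BL′ ⊆ BL`, hence `switchMap ζ ∈ MinusSet`) are the next file.
-/

namespace Summit.Ventures.PercRepro2

namespace Switch

open Hull

variable {V : Type*} {E : Type*} [DecidableEq E]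

/-! ## Definitions -/

/-- `Q̂ = {h ∉ C_R(l)} ∩ {h ∉ C_B(l)}` on the minor with free edges `G`. -/
def Qhat (ends : E → Sym2 V) (G : Finset E) (ζ : Config E) (l h : V) : Prop :=
  h ∉ cluster ends ζ l ∧ h ∉ cluster ends (flipOn G ζ) l

/-- The `+1` configurations `P = {Q̂, o ∈ RL ∖ BL, b ∈ RH ∖ BH}`. -/
def PlusSet (ends : E → Sym2 V) (G : Finset E) (ζ : Config E) (l h o b : V) : Prop :=
  Qhat ends G ζ l h ∧ (o ∈ cluster ends ζ l ∧ o ∉ cluster ends (flipOn G ζ) l) ∧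
    (b ∈ cluster ends ζ h ∧ b ∉ cluster ends (flipOn G ζ) h)

/-- The `−1` configurations with the side of `o` unchanged, `M1 = {Q̂, o ∈ RL ∖ BL, b ∈ BH ∖ RH}`. -/
def MinusSet (ends : E → Sym2 V) (G : Finset E) (ζ : Config E) (l h o b : V) : Prop :=
  Qhat ends G ζ l h ∧ (o ∈ cluster ends ζ l ∧ o ∉ cluster ends (flipOn G ζ) l) ∧
    (b ∈ cluster ends (flipOn G ζ) h ∧ b ∉ cluster ends ζ h)

open scoped Classical in
/-- `flip_S`: recolour every free edge with an endpoint in `S`. -/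
noncomputable def freeFlip (ends : E → Sym2 V) (G : Finset E) (S : Set V) (ζ : Config E) :
    Config E :=
  fun e => if e ∈ G ∧ e ∈ touches ends S then !ζ e else ζ e

/-- The kept region `K = RL ∪ BH`. -/
def kept (ends : E → Sym2 V) (G : Finset E) (ζ : Config E) (l h : V) : Set V :=
  cluster ends ζ l ∪ cluster ends (flipOn G ζ) h

open scoped Classical in
/-- The red edges touching `W = V ∖ K`. -/
noncomputable def redW (ends : E → Sym2 V) (G : Finset E) (ζ : Config E) (l h : V) : Config E :=
  fun e => ζ e && decide (e ∈ touches ends (kept ends G ζ l h)ᶜ)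

/-- `R⁺`: the vertices of `W` reached from `BH` by red paths through edges touching `W`. -/
def Rplus (ends : E → Sym2 V) (G : Finset E) (ζ : Config E) (l h : V) : Set V :=
  {w | w ∉ kept ends G ζ l h ∧ ∃ y ∈ cluster ends (flipOn G ζ) h, Conn ends (redW ends G ζ l h) y w}

/-- The total switching map `ζ ↦ flip_{R⁺}(ζ)`. -/
noncomputable def switchMap (ends : E → Sym2 V) (G : Finset E) (ζ : Config E) (l h : V) :
    Config E :=
  freeFlip ends G (Rplus ends G ζ l h) ζ

variable {ends : E → Sym2 V} {G : Finset E} {ζ : Config E} {l h : V}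

/-! ## Elementary facts -/

/-- `freeFlip` on a flipped edge. -/
lemma freeFlip_apply_of_mem {S : Set V} {e : E} (hG : e ∈ G) (hS : e ∈ touches ends S) :
    freeFlip ends G S ζ e = !ζ e := by
  simp [freeFlip, hG, hS]

/-- `freeFlip` on an edge not flipped. -/
lemma freeFlip_apply_of_not {S : Set V} {e : E} (h : ¬ (e ∈ G ∧ e ∈ touches ends S)) :
    freeFlip ends G S ζ e = ζ e := by
  simp only [freeFlip]
  rw [if_neg h]

/-- The blue graph of `freeFlip` on an edge not flipped. -/
lemma flipOn_freeFlip_apply_of_not {S : Set V} {e : E} (h : ¬ (e ∈ G ∧ e ∈ touches ends S)) :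
    flipOn G (freeFlip ends G S ζ) e = flipOn G ζ e := by
  by_cases hG : e ∈ G
  · rw [flipOn_of_mem G _ hG, flipOn_of_mem G ζ hG, freeFlip_apply_of_not h]
  · rw [flipOn_of_notMem G _ hG, flipOn_of_notMem G ζ hG, freeFlip_apply_of_not h]

/-- The blue graph of `freeFlip` on a flipped edge is the red graph. -/
lemma flipOn_freeFlip_apply_of_mem {S : Set V} {e : E} (hG : e ∈ G) (hS : e ∈ touches ends S) :
    flipOn G (freeFlip ends G S ζ) e = ζ e := by
  rw [flipOn_of_mem G _ hG, freeFlip_apply_of_mem hG hS, Bool.not_not]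

/-- A pinned-open edge is open in both colours. -/
lemma flipOn_of_notMem_of_eq_true {e : E} (hG : e ∉ G) (he : ζ e = true) : flipOn G ζ e = true := by
  rw [flipOn_of_notMem G ζ hG]; exact he

/-- `redW` is below the red graph. -/
lemma redW_le : redW ends G ζ l h ≤ ζ := by
  intro e
  simp only [redW]
  cases ζ e <;> simp

/-- `redW` on a red edge touching `W`. -/
lemma redW_eq_true {e : E} (he : ζ e = true) (hW : e ∈ touches ends (kept ends G ζ l h)ᶜ) :
    redW ends G ζ l h e = true := by
  simp [redW, he, hW]

/-- (F1): a blue edge with an endpoint in `BH` has its other endpoint in `BH`. -/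
lemma mem_BH_of_blue_edge {x y : V} {e : E} (hx : x ∈ cluster ends (flipOn G ζ) h)
    (he : flipOn G ζ e = true) (hends : ends e = s(x, y)) : y ∈ cluster ends (flipOn G ζ) h :=
  mem_cluster_of_edge hx he hends

omit [DecidableEq E] in
/-- (F2): a red edge with an endpoint in `RL` has its other endpoint in `RL`. -/
lemma mem_RL_of_red_edge {x y : V} {e : E} (hx : x ∈ cluster ends ζ l) (he : ζ e = true)
    (hends : ends e = s(x, y)) : y ∈ cluster ends ζ l :=
  mem_cluster_of_edge hx he hends

/-- `R⁺ ⊆ W`. -/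
lemma Rplus_subset_compl_kept : Rplus ends G ζ l h ⊆ (kept ends G ζ l h)ᶜ :=
  fun _ hw => hw.1

/-- `R⁺` avoids `RL`. -/
lemma notMem_RL_of_mem_Rplus {w : V} (hw : w ∈ Rplus ends G ζ l h) : w ∉ cluster ends ζ l :=
  fun hR => hw.1 (Or.inl hR)

/-- `R⁺` avoids `BH`. -/
lemma notMem_BH_of_mem_Rplus {w : V} (hw : w ∈ Rplus ends G ζ l h) :
    w ∉ cluster ends (flipOn G ζ) h :=
  fun hB => hw.1 (Or.inr hB)

/-- (F3), first half: a red edge from `BH` into `W` lands in `R⁺`. -/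
lemma mem_Rplus_of_red_edge_BH {y w : V} {e : E} (hy : y ∈ cluster ends (flipOn G ζ) h)
    (hw : w ∉ kept ends G ζ l h) (he : ζ e = true) (hends : ends e = s(y, w)) :
    w ∈ Rplus ends G ζ l h := by
  refine ⟨hw, y, hy, ?_⟩
  have hW : e ∈ touches ends (kept ends G ζ l h)ᶜ := mem_touches_of_ends hends (Or.inr hw)
  exact mem_cluster_of_edge (mem_cluster_self _ _ _) (redW_eq_true he hW) hends

/-- (F3), second half: a red edge from `R⁺` leaves into `R⁺ ∪ BH`. -/
lemma mem_Rplus_or_BH_of_red_edge {r x : V} {e : E} (hr : r ∈ Rplus ends G ζ l h) (he : ζ e = true)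
    (hends : ends e = s(r, x)) : x ∈ Rplus ends G ζ l h ∨ x ∈ cluster ends (flipOn G ζ) h := by
  by_cases hxK : x ∈ kept ends G ζ l h
  · rcases hxK with hxR | hxB
    · exact absurd (mem_RL_of_red_edge hxR he (ends_swap hends)) (notMem_RL_of_mem_Rplus hr)
    · exact Or.inr hxB
  · obtain ⟨hrW, y, hy, hyr⟩ := hr
    refine Or.inl ⟨hxK, y, hy, ?_⟩
    have hW : e ∈ touches ends (kept ends G ζ l h)ᶜ := mem_touches_of_ends hends (Or.inl hrW)
    exact mem_cluster_of_edge hyr (redW_eq_true he hW) hends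

/-- The edges of a `redW`-path from `BH` touch `R⁺`: every `W`-vertex reached from `BH` is in `R⁺`. -/
lemma mem_Rplus_of_conn_redW {y w : V} (hy : y ∈ cluster ends (flipOn G ζ) h)
    (hw : w ∉ kept ends G ζ l h) (hc : Conn ends (redW ends G ζ l h) y w) : w ∈ Rplus ends G ζ l h :=
  ⟨hw, y, hy, hc⟩

/-! ## The switching map: `RL ⊆ RL′` and `BH ∪ R⁺ ⊆ BH′` -/

/-- (d) `RL ⊆ RL(ζ′)`: red edges inside `RL` do not touch `R⁺`. -/
theorem cluster_subset_switch : cluster ends ζ l ⊆ cluster ends (switchMap ends G ζ l h) l := by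
  intro u hu
  have key : u ∈ cluster ends (switchMap ends G ζ l h) l ∩ cluster ends ζ l := by
    refine mem_of_conn_of_closed (ends := ends) (ω := ζ) ?_
      ⟨mem_cluster_self _ _ _, mem_cluster_self _ _ _⟩ hu
    intro x hx y hxy
    obtain ⟨_, e, he, hends⟩ := exists_edge_of_adj hxy
    have hyR : y ∈ cluster ends ζ l := mem_RL_of_red_edge hx.2 he hends
    have hnot : ¬ (e ∈ G ∧ e ∈ touches ends (Rplus ends G ζ l h)) := fun ⟨_, ht⟩ => by
      rcases (mem_touches_iff_of_ends hends).1 ht with hP | hP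
      · exact notMem_RL_of_mem_Rplus hP hx.2
      · exact notMem_RL_of_mem_Rplus hP hyR
    have he' : switchMap ends G ζ l h e = true := by
      unfold switchMap; rw [freeFlip_apply_of_not hnot]; exact he
    exact ⟨mem_cluster_of_edge hx.1 he' hends, hyR⟩
  exact key.1

/-- (a), first part: `BH ⊆ BH(ζ′)`: blue edges inside `BH` do not touch `R⁺`. -/
theorem cluster_blue_subset_switch :
    cluster ends (flipOn G ζ) h ⊆ cluster ends (flipOn G (switchMap ends G ζ l h)) h := by
  intro u hu
  have key : u ∈ cluster ends (flipOn G (switchMap ends G ζ l h)) h ∩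
      cluster ends (flipOn G ζ) h := by
    refine mem_of_conn_of_closed (ends := ends) (ω := flipOn G ζ) ?_
      ⟨mem_cluster_self _ _ _, mem_cluster_self _ _ _⟩ hu
    intro x hx y hxy
    obtain ⟨_, e, he, hends⟩ := exists_edge_of_adj hxy
    have hyB : y ∈ cluster ends (flipOn G ζ) h := mem_BH_of_blue_edge hx.2 he hends
    have hnot : ¬ (e ∈ G ∧ e ∈ touches ends (Rplus ends G ζ l h)) := fun ⟨_, ht⟩ => by
      rcases (mem_touches_iff_of_ends hends).1 ht with hP | hP
      · exact notMem_BH_of_mem_Rplus hP hx.2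
      · exact notMem_BH_of_mem_Rplus hP hyB
    have he' : flipOn G (switchMap ends G ζ l h) e = true := by
      unfold switchMap; rw [flipOn_freeFlip_apply_of_not hnot]; exact he
    exact ⟨mem_cluster_of_edge hx.1 he' hends, hyB⟩
  exact key.1

/-- (a), second part: `R⁺ ⊆ BH(ζ′)`: the red paths from `BH` into `R⁺` turn blue. -/
theorem Rplus_subset_cluster_blue_switch :
    Rplus ends G ζ l h ⊆ cluster ends (flipOn G (switchMap ends G ζ l h)) h := by
  rintro w ⟨hwW, y, hy, hc⟩
  have key : w ∈ {u | Conn ends (redW ends G ζ l h) y u ∧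
      Conn ends (flipOn G (switchMap ends G ζ l h)) y u} := by
    refine mem_of_conn_of_closed (ends := ends) (ω := redW ends G ζ l h) ?_
      ⟨conn_refl _ _ _, conn_refl _ _ _⟩ hc
    intro x hx u hxu
    obtain ⟨_, e, he, hends⟩ := exists_edge_of_adj hxu
    have heR : ζ e = true := by
      have := redW_le (ends := ends) (G := G) (ζ := ζ) (l := l) (h := h) e
      rw [he] at this
      exact Bool.le_iff_imp.1 this rfl
    have heW : e ∈ touches ends (kept ends G ζ l h)ᶜ := by
      by_contra hW
      simp [redW, heR, hW] at he
    have hcu : Conn ends (redW ends G ζ l h) y u := mem_cluster_of_edge hx.1 he hends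
    -- the edge touches `R⁺` (its `W`-endpoint is reached from `BH`)
    have htouch : e ∈ touches ends (Rplus ends G ζ l h) := by
      rcases (mem_touches_iff_of_ends hends).1 heW with hxW | huW
      · exact mem_touches_of_ends hends (Or.inl (mem_Rplus_of_conn_redW hy hxW hx.1))
      · exact mem_touches_of_ends hends (Or.inr (mem_Rplus_of_conn_redW hy huW hcu))
    have he' : flipOn G (switchMap ends G ζ l h) e = true := by
      by_cases hG : e ∈ G
      · unfold switchMap; rw [flipOn_freeFlip_apply_of_mem hG htouch]; exact heR
      · rw [flipOn_of_notMem G _ hG]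
        unfold switchMap
        rw [freeFlip_apply_of_not (fun hh => hG hh.1)]
        exact heR
    exact ⟨hcu, mem_cluster_of_edge hx.2 he' hends⟩
  exact conn_trans (cluster_blue_subset_switch hy) key.2

end Switch

end Summit.Ventures.PercRepro2
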